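import Literature.Probability.LatticeModels.GibbsSpecificationTilted
import HarnessLib

/-!
# Ratio bounds for tilted measures and for glued Gibbsian kernels

Third companion ("Proofs") file of `Literature/Probability/LatticeModels/GibbsSpecification.lean`:
the elementary comparison of two Gibbsian kernels whose energies are uniformly close up to a
constant — the finite-volume form of "a perturbation of the Hamiltonian of sup-norm `ε` changes
expectations of nonnegative observables by at most the factor `e^{2ε}`" (Georgii 2011, proof of
Prop. 8.8 / Rem. 8.11; Friedli–Velenik 2017, §6.4, the comparison of `π_Λ^{Φ}` and `π_Λ^{Ψ}`),
for Mathlib's `Measure.tilted` and the glued kernels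
`((ν^{⊗Λ}) ∘ glueWith⁻¹(·, η)).tilted φ` of `GibbsSpecificationTilted.lean`.

## Main results (theorems only: no definition, no named fact)

* `integral_tilted_le_exp_mul` — two tilts of ONE nonzero finite measure by bounded measurable
  energies `φ, ψ` with `|φ - ψ - c| ≤ ε` pointwise give expectations of `[0,1]`-valued measurable
  observables within the factor `e^{2ε}` (numerator gains at most `e^{c+ε}`, normaliser loses at
  most `e^{c-ε}`);
* `integral_tilted_map_eq_integral_tilted_comp` — pull-back of a tilt of an image measure:
  `∫ f d((π ∘ F⁻¹).tilted Φ) = ∫ (f ∘ F) d(π.tilted (Φ ∘ F))`;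
* `integral_glued_tilted_le_exp_mul` — the two combined: the kernels glued with two exteriors
  `ζ₁, ζ₂` and tilted by two energies `Φ₁, Φ₂` compare within `e^{2ε}` for every `[0,1]`-valued
  observable not distinguishing the two glued configurations, as soon as the pulled-back energies
  satisfy `|Φ₁(u ζ₁) - Φ₂(u ζ₂) - c| ≤ ε` (the form consumed by local-absolute-continuity and
  quasi-locality estimates of perturbed lattice gauge kernels,
  `MathematicalPhysics/QuantumFieldTheory/QuasiLocalGaugePerturbationKernels.lean`).

## References

* H.-O. Georgii, *Gibbs Measures and Phase Transitions*, 2nd ed. (de Gruyter 2011), Ch. 8.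
* S. Friedli, Y. Velenik, *Statistical Mechanics of Lattice Systems* (CUP 2017), §6.4, §6.10.1.
-/

noncomputable section

open MeasureTheory
open scoped ENNReal

namespace Literature.Probability.LatticeModels

section Ratio

variable {Y : Type*} [MeasurableSpace Y]

/-- Bounded measurable energies have integrable Boltzmann factors on a finite measure space.
[folklore] -/
theorem integrable_exp_of_abs_le (π : Measure Y) [IsFiniteMeasure π] {φ : Y → ℝ}
    (hφ : Measurable φ) (hφb : ∃ C, ∀ y, |φ y| ≤ C) :
    Integrable (fun y => Real.exp (φ y)) π := by
  obtain ⟨C, hC⟩ := hφb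
  refine Integrable.of_bound hφ.exp.aestronglyMeasurable (Real.exp C) (ae_of_all _ fun y => ?_)
  rw [Real.norm_eq_abs, Real.abs_exp, Real.exp_le_exp]
  exact (le_abs_self _).trans (hC y)

/-- **Ratio of two tilts of one measure.** If `|φ - ψ - c| ≤ ε` pointwise for bounded measurable
energies on a nonzero finite measure space, then for every measurable `g` with values in `[0,1]`,
`∫ g d(π.tilted φ) ≤ e^{2ε} ∫ g d(π.tilted ψ)`: the numerator gains at most `e^{c+ε}`, the
normaliser loses at most `e^{c-ε}`. [folklore] -/
theorem integral_tilted_le_exp_mul (π : Measure Y) [IsFiniteMeasure π] [NeZero π]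
    {φ ψ g : Y → ℝ} (hφ : Measurable φ) (hψ : Measurable ψ) (hφb : ∃ C, ∀ y, |φ y| ≤ C)
    (hψb : ∃ C, ∀ y, |ψ y| ≤ C) (hg : Measurable g) (hg01 : ∀ y, 0 ≤ g y ∧ g y ≤ 1)
    {c ε : ℝ} (h : ∀ y, |φ y - ψ y - c| ≤ ε) :
    ∫ y, g y ∂(π.tilted φ) ≤ Real.exp (2 * ε) * ∫ y, g y ∂(π.tilted ψ) := by
  have hiφ := integrable_exp_of_abs_le π hφ hφb
  have hiψ := integrable_exp_of_abs_le π hψ hψb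
  -- integrability of the weighted observables
  have hgi : ∀ {θ : Y → ℝ}, Measurable θ → (∃ C, ∀ y, |θ y| ≤ C) →
      Integrable (fun y => Real.exp (θ y) * g y) π := fun {θ} hθ hθb => by
    obtain ⟨C, hC⟩ := hθb
    refine Integrable.of_bound (hθ.exp.mul hg).aestronglyMeasurable (Real.exp C)
      (ae_of_all _ fun y => ?_)
    rw [Real.norm_eq_abs, abs_mul, Real.abs_exp, abs_of_nonneg (hg01 y).1]
    calc Real.exp (θ y) * g y ≤ Real.exp (θ y) * 1 :=
          mul_le_mul_of_nonneg_left (hg01 y).2 (Real.exp_pos _).le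
      _ ≤ Real.exp C := by
          rw [mul_one, Real.exp_le_exp]; exact (le_abs_self _).trans (hC y)
  have hZψ : 0 < ∫ y, Real.exp (ψ y) ∂π := integral_exp_pos hiψ
  -- pointwise comparison of the Boltzmann factors
  have hup : ∀ y, Real.exp (φ y) ≤ Real.exp (c + ε) * Real.exp (ψ y) := fun y => by
    rw [← Real.exp_add, Real.exp_le_exp]; have := (abs_le.1 (h y)).2; linarith
  have hlow : ∀ y, Real.exp (c - ε) * Real.exp (ψ y) ≤ Real.exp (φ y) := fun y => by
    rw [← Real.exp_add, Real.exp_le_exp]; have := (abs_le.1 (h y)).1; linarith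
  have hN : ∫ y, Real.exp (φ y) * g y ∂π ≤
      Real.exp (c + ε) * ∫ y, Real.exp (ψ y) * g y ∂π := by
    rw [← integral_const_mul]
    refine integral_mono (hgi hφ hφb) ((hgi hψ hψb).const_mul _) fun y => ?_
    simp only
    rw [← mul_assoc]
    exact mul_le_mul_of_nonneg_right (hup y) (hg01 y).1
  have hZ : Real.exp (c - ε) * ∫ y, Real.exp (ψ y) ∂π ≤ ∫ y, Real.exp (φ y) ∂π := by
    rw [← integral_const_mul]
    exact integral_mono (hiψ.const_mul _) hiφ fun y => hlow y
  have hNψ : 0 ≤ ∫ y, Real.exp (ψ y) * g y ∂π :=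
    integral_nonneg fun y => mul_nonneg (Real.exp_pos _).le (hg01 y).1
  -- the two tilted integrals as ratios
  have hrat : ∀ θ : Y → ℝ, ∫ y, g y ∂(π.tilted θ) =
      (∫ y, Real.exp (θ y) * g y ∂π) / ∫ y, Real.exp (θ y) ∂π := fun θ => by
    rw [integral_tilted]
    simp_rw [smul_eq_mul, div_mul_eq_mul_div]
    rw [integral_div]
  rw [hrat φ, hrat ψ]
  calc (∫ y, Real.exp (φ y) * g y ∂π) / ∫ y, Real.exp (φ y) ∂π
      ≤ (Real.exp (c + ε) * ∫ y, Real.exp (ψ y) * g y ∂π) /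
          (Real.exp (c - ε) * ∫ y, Real.exp (ψ y) ∂π) :=
        div_le_div₀ (mul_nonneg (Real.exp_pos _).le hNψ) hN (mul_pos (Real.exp_pos _) hZψ) hZ
    _ = Real.exp (2 * ε) *
          ((∫ y, Real.exp (ψ y) * g y ∂π) / ∫ y, Real.exp (ψ y) ∂π) := by
        rw [mul_div_mul_comm, ← Real.exp_sub]
        congr 1
        ring_nf

/-- **Pull-back of a tilt of an image measure**: integrating `f` against `(π ∘ F⁻¹).tilted Φ` is
integrating `f ∘ F` against `π.tilted (Φ ∘ F)`. [folklore] -/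
theorem integral_tilted_map_eq_integral_tilted_comp {X : Type*} [MeasurableSpace X]
    (π : Measure Y) {F : Y → X} (hF : Measurable F) {Φ : X → ℝ} (hΦ : Measurable Φ)
    {f : X → ℝ} (hf : Measurable f) :
    ∫ x, f x ∂((π.map F).tilted Φ) = ∫ y, f (F y) ∂(π.tilted (Φ ∘ F)) := by
  have hZ : ∫ x, Real.exp (Φ x) ∂(π.map F) = ∫ y, Real.exp (Φ (F y)) ∂π :=
    integral_map hF.aemeasurable hΦ.exp.aestronglyMeasurable
  rw [integral_tilted, integral_tilted, hZ, integral_map hF.aemeasurable]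
  · rfl
  · exact ((hΦ.exp.div_const _).smul hf).aestronglyMeasurable

end Ratio

section Glued

variable {V S : Type*} [MeasurableSpace S]

/-- **Comparison of two glued tilted kernels.** For a probability a priori measure `ν`, two
exteriors `ζ₁, ζ₂`, two bounded measurable energies `Φ₁, Φ₂` and a `[0,1]`-valued measurable
observable `f` that does not distinguish the two glued configurations, if the pulled-back energies
differ by a constant up to `ε`, `|Φ₁(u ζ₁) - Φ₂(u ζ₂) - c| ≤ ε`, then
`∫ f d((ν^{⊗Λ} ∘ glue(·,ζ₁)⁻¹).tilted Φ₁) ≤ e^{2ε} ∫ f d((ν^{⊗Λ} ∘ glue(·,ζ₂)⁻¹).tilted Φ₂)`.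
[folklore] -/
theorem integral_glued_tilted_le_exp_mul (ν : Measure S) [IsProbabilityMeasure ν] (Λ : Finset V)
    (ζ₁ ζ₂ : V → S) {Φ₁ Φ₂ : (V → S) → ℝ} (hΦ₁ : Measurable Φ₁) (hΦ₂ : Measurable Φ₂)
    (hΦ₁b : ∃ C, ∀ σ, |Φ₁ σ| ≤ C) (hΦ₂b : ∃ C, ∀ σ, |Φ₂ σ| ≤ C)
    {f : (V → S) → ℝ} (hf : Measurable f) (hf01 : ∀ σ, 0 ≤ f σ ∧ f σ ≤ 1)
    (hfζ : ∀ u : Λ → S, f (glueWith Λ u ζ₁) = f (glueWith Λ u ζ₂))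
    {c ε : ℝ} (h : ∀ u : Λ → S, |Φ₁ (glueWith Λ u ζ₁) - Φ₂ (glueWith Λ u ζ₂) - c| ≤ ε) :
    ∫ σ, f σ ∂(((Measure.pi fun _ : Λ => ν).map (glueWith Λ · ζ₁)).tilted Φ₁) ≤
      Real.exp (2 * ε) *
        ∫ σ, f σ ∂(((Measure.pi fun _ : Λ => ν).map (glueWith Λ · ζ₂)).tilted Φ₂) := by
  rw [integral_tilted_map_eq_integral_tilted_comp _ (measurable_glueWith Λ ζ₁) hΦ₁ hf,
    integral_tilted_map_eq_integral_tilted_comp _ (measurable_glueWith Λ ζ₂) hΦ₂ hf]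
  simp_rw [hfζ]
  obtain ⟨C₁, hC₁⟩ := hΦ₁b
  obtain ⟨C₂, hC₂⟩ := hΦ₂b
  exact integral_tilted_le_exp_mul (Measure.pi fun _ : Λ => ν)
    (hΦ₁.comp (measurable_glueWith Λ ζ₁)) (hΦ₂.comp (measurable_glueWith Λ ζ₂))
    ⟨C₁, fun u => hC₁ _⟩ ⟨C₂, fun u => hC₂ _⟩ (hf.comp (measurable_glueWith Λ ζ₂))
    (fun u => hf01 _) h

end Glued

end Literature.Probability.LatticeModels

end
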